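import Summits.HodgeConjecture.CorCM.Census.OcticTwistScrewFamily

/-!
# The octic twist `(ℤ/8 × B, (4,0))`, XXVII: THE SCREW COLUMN (d) — the BI-AFFINE REDUCTION and the Weil lift handed over by a screw
# pair type

COR-CM (cell `pub-hodgecm2`), count-neutral kernel combinatorics by the binder seat b09 (gen 35; lane COINVARIANT-TWIST / OCTIC RECON, the
screw column), on top of parts XXIV–XXVI (`raffine`, `raffine_square`, `raffine_atom`, `raffine_two_atom`, `transl_raffine`, the junk
calculus, `cst_tens_shift_mem`; `Shaped`; `exists_screw_family`) and parts I–XII (`tens`, `transl₂_true_tens`, `transl₂_single`, `cface₀_eq`,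
`cface₁_eq`, `exists_of_pot_le_one`, `two_le_Phi_of_not_isRes`) BY NAME.  Theorems only; no definition, no certificate, no named fact, no
`sorry`.
HONEST FRAMING: `HC_CM` is NOT proved, here or anywhere in the tree; nothing here is a period or a headline.

* §1 **THE BI-AFFINE REDUCTION** (`biaffine_mem`, `|B| ≥ 3`): if the reducing faces of `N` through the pair types with two unbalanced
  coordinates are `Shaped`, then for every pair type `(s, t)` with upper ends `u`, `v`:
  `e_{(s,t)} − raffine u s ⊗ raffine v t ∈ N` (strong induction on the octic potential: oriented squares telescope by `raffine_square`
  in the active coordinate, read at the SAME upper end by `isUpper_unique`; column relations telescope by `raffine_two_atom`).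
  Corollaries `biaffine_of_square₁` / `biaffine_of_square₀`: a coordinate-`1` (resp. `0`) cross square through `(x, t)` whose corners have
  upper end `v` reduces `e_{(x,t)}` to `raffine u x ⊗ raffine v t` for ANY `t` (balanced or not).
* §2 **THE SCREW HANDS OVER A WEIL LIFT** (`cst_tens_Wvec_mem_of_screw`).  Let `T₀ = (ψ, ψ′)` be fixed by the odd motion `act true (0,τ)`
  (`ψ′ = (0,τ)·ψ`, `(1,τ)·ψ′ = ψ`), `ψ⁻` a neighbour of `ψ` with upper end `v`, `ψ′⁻ = (0,τ)·ψ⁻`, and let `N` (motion-stable, with the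
  octic pairs, the mixed squares, the D-moves and the coordinate-`1` X-lifts) contain the mixed face `(e_ψ − e_{ψ⁻}) ⊗ (e_{ψ′} − e_{ψ′⁻})`
  and a coordinate-`1` square `e_{ψ⁻} ⊗ (ψ′; p′, q′)` offering the upper end `v`.  Reducing `e_{T₀}` through the mixed face and comparing
  with the transported reduction gives `raffine (v+1) ψ⁻⁻ ⊗ (raffine (v+1) ψ′ − raffine v ψ′⁻) − raffine v ψ⁻ ⊗ (raffine v ψ′ − raffine v ψ′⁻)
  ∈ N`; the junk calculus strips everything but `e_{v+1} ⊗ (raffine (v+1) ψ′ − raffine v ψ′)`, and the shift identity turns it into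
  **`e_{cst (v+1)} ⊗ w_{v+1} ∈ N`** — a Weil lift of the class that the equatorial closing face `⊗ e_0` used to supply.
All [folklore].

## References
* [Pohlmann1968] H. Pohlmann, Algebraic cycles on abelian varieties of complex multiplication type, Ann. of Math. 88 (1968), Thm 1.
-/

namespace Summit.HodgeConjecture.CorCM.Census.OcticTwist

open Finset
open Summit.HodgeConjecture.CorCM.Census.QuarticTwist

variable (B : Type) [AddGroup B] [Fintype B] [DecidableEq B]

/-! ## §1 The bi-affine reduction -/

omit [AddGroup B] in
/-- On a small residual type with upper end `u`, `raffine u` is the unit vector. [folklore] -/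
theorem raffine_eq_single_of_smallRes (h3 : 3 ≤ Fintype.card B) {s : Ty B} (hs : IsRes B s) (h2 : ¬ ∃ (u : ZMod 4) (b : B), s = atom B u b 2)
    {u : ZMod 4} (hu : IsUpper B u s) : raffine B u s = Pi.single s 1 := by
  obtain ⟨u₀, b, k, rfl⟩ := hs
  have hk : k ≠ 2 := fun h => h2 ⟨u₀, b, by rw [h]⟩
  have key : ∀ k : ZMod 4, k ≠ 2 → k = 0 ∨ k = 1 ∨ k = -1 := by decide
  rw [isUpper_unique B (isUpper_atom B h3 u₀ b k) hu]
  exact raffine_atom B u₀ b (key k hk)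

omit [AddGroup B] in
/-- A type of potential `≤ 1` is small residual. [folklore] -/
theorem smallRes_of_Phi_le_one (h3 : 3 ≤ Fintype.card B) {s : Ty B} (hs : Phi B s ≤ 1) :
    IsRes B s ∧ ¬ ∃ (u : ZMod 4) (b : B), s = atom B u b 2 := by
  have hres : IsRes B s := by
    by_contra h
    have := two_le_Phi_of_not_isRes B h3 h; omega
  refine ⟨hres, ?_⟩
  rintro ⟨u, b, rfl⟩
  rw [Phi_atom B h3] at hs
  exact absurd hs (by decide)

omit [AddGroup B] [DecidableEq B] in
/-- An upper end excludes balancedness. [folklore] -/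
theorem not_balanced_of_isUpper {s : Ty B} {u : ZMod 4} (hu : IsUpper B u s) : ¬ ∀ w, IsMin B w s := fun h => hu.2 (h (u + 1))

omit [AddGroup B] in
/-- **THE BI-AFFINE REDUCTION** (`|B| ≥ 3`): if the reducing faces of `N` through the pair types of potential `≥ 2` with two unbalanced
coordinates are shaped, then `e_{(s,t)} − raffine u s ⊗ raffine v t ∈ N` whenever `u`, `v` are the upper ends of `s`, `t`. [folklore] -/
theorem biaffine_mem (h3 : 3 ≤ Fintype.card B) {N : Submodule ℤ (Ty₂ B → ℤ)}
    (hShape : ∀ T : Ty₂ B, 2 ≤ pot B T → (¬ ∀ w, IsMin B w T.1) → (¬ ∀ w, IsMin B w T.2) → Shaped B N T)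
    (s t : Ty B) {u v : ZMod 4} (hu : IsUpper B u s) (hv : IsUpper B v t) :
    Pi.single (s, t) 1 - tens B (raffine B u s) (raffine B v t) ∈ N := by
  induction hn : pot B (s, t) using Nat.strong_induction_on generalizing s t u v with
  | _ n ih =>
  by_cases hT : 2 ≤ pot B (s, t)
  swap
  · -- both coordinates small residual: nothing to reduce
    rw [pot_mk] at hT
    obtain ⟨hs, hs2⟩ := smallRes_of_Phi_le_one B h3 (s := s) (by omega)
    obtain ⟨ht, ht2⟩ := smallRes_of_Phi_le_one B h3 (s := t) (by omega)
    rw [raffine_eq_single_of_smallRes B h3 hs hs2 hu, raffine_eq_single_of_smallRes B h3 ht ht2 hv, ← single_eq_tens, sub_self]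
    exact Submodule.zero_mem _
  -- the induction hypothesis at a corner
  have IH : ∀ (s' t' : Ty B) (u' v' : ZMod 4), pot B (s', t') < pot B (s, t) → IsUpper B u' s' → IsUpper B v' t' →
      Pi.single (s', t') 1 - tens B (raffine B u' s') (raffine B v' t') ∈ N :=
    fun s' t' u' v' hlt hu' hv' => ih _ (hn ▸ hlt) s' t' hu' hv' rfl
  rcases hShape (s, t) hT (not_balanced_of_isUpper B hu) (not_balanced_of_isUpper B hv) with
    ⟨hs, hs2, ht, ht2⟩ | ⟨u', p, q, hpq, hf, hor, ⟨h1, r1⟩, ⟨h2, r2⟩, ⟨h12, r12⟩⟩ | ⟨v', p, q, hpq, hf, hor, ⟨h1, r1⟩, ⟨h2, r2⟩, ⟨h12, r12⟩⟩ |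
    ⟨u', b, hsb, hrel⟩ | ⟨v', b, htb, hrel⟩
  · -- (RR)
    rw [raffine_eq_single_of_smallRes B h3 hs hs2 hu, raffine_eq_single_of_smallRes B h3 ht ht2 hv, ← single_eq_tens, sub_self]
    exact Submodule.zero_mem _
  · -- (S0) oriented square in coordinate 0
    simp only at hpq hf hor h1 r1 h2 r2 h12 r12
    have hu' : u' = u := by
      rcases hor with hbal | hu'
      · exact absurd hbal (not_balanced_of_isUpper B hu)
      · exact isUpper_unique B hu hu'
    subst hu'
    have i₁ := IH _ t u' v (by rw [pot_mk, pot_mk]; omega) r1 hv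
    have i₂ := IH _ t u' v (by rw [pot_mk, pot_mk]; omega) r2 hv
    have i₁₂ := IH _ t u' v (by rw [pot_mk, pot_mk]; omega) r12 hv
    obtain ⟨e₁, he₁⟩ : ∃ e₁, step p.1 (s p.2) = e₁ := ⟨_, rfl⟩
    obtain ⟨e₂, he₂⟩ : ∃ e₂, step q.1 (s q.2) = e₂ := ⟨_, rfl⟩
    have hs₁ : QuarticTwist.flip B p s = s + Pi.single p.2 e₁ := by rw [flip_eq_add_single, he₁]
    have hs₂ : QuarticTwist.flip B q s = s + Pi.single q.2 e₂ := by rw [flip_eq_add_single, he₂]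
    have hs₁₂ : QuarticTwist.flip B q (QuarticTwist.flip B p s) = s + Pi.single p.2 e₁ + Pi.single q.2 e₂ := by
      rw [flip_flip_of_ne B p q hpq s, he₁, he₂]
    have hadd := raffine_square B u' s hpq e₁ e₂
    rw [← hs₁₂, ← hs₁, ← hs₂] at hadd
    rw [cface₀_eq] at hf
    have key : Pi.single (s, t) 1 - tens B (raffine B u' s) (raffine B v t)
        = (Pi.single (s, t) 1 - Pi.single (QuarticTwist.flip B p s, t) 1 - Pi.single (QuarticTwist.flip B q s, t) 1
            + Pi.single (QuarticTwist.flip B q (QuarticTwist.flip B p s), t) 1)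
          + (Pi.single (QuarticTwist.flip B p s, t) 1 - tens B (raffine B u' (QuarticTwist.flip B p s)) (raffine B v t))
          + (Pi.single (QuarticTwist.flip B q s, t) 1 - tens B (raffine B u' (QuarticTwist.flip B q s)) (raffine B v t))
          - (Pi.single (QuarticTwist.flip B q (QuarticTwist.flip B p s), t) 1
              - tens B (raffine B u' (QuarticTwist.flip B q (QuarticTwist.flip B p s))) (raffine B v t))
          - tens B (raffine B u' s - raffine B u' (QuarticTwist.flip B p s) - raffine B u' (QuarticTwist.flip B q s)
              + raffine B u' (QuarticTwist.flip B q (QuarticTwist.flip B p s))) (raffine B v t) := by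
      rw [tens_add_left, tens_sub_left, tens_sub_left]; abel
    rw [key, hadd, tens_zero_left, sub_zero]
    exact Submodule.sub_mem _ (Submodule.add_mem _ (Submodule.add_mem _ hf i₁) i₂) i₁₂
  · -- (S1) oriented square in coordinate 1
    simp only at hpq hf hor h1 r1 h2 r2 h12 r12
    have hv' : v' = v := by
      rcases hor with hbal | hv'
      · exact absurd hbal (not_balanced_of_isUpper B hv)
      · exact isUpper_unique B hv hv'
    subst hv'
    have i₁ := IH s _ u v' (by rw [pot_mk, pot_mk]; omega) hu r1
    have i₂ := IH s _ u v' (by rw [pot_mk, pot_mk]; omega) hu r2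
    have i₁₂ := IH s _ u v' (by rw [pot_mk, pot_mk]; omega) hu r12
    obtain ⟨e₁, he₁⟩ : ∃ e₁, step p.1 (t p.2) = e₁ := ⟨_, rfl⟩
    obtain ⟨e₂, he₂⟩ : ∃ e₂, step q.1 (t q.2) = e₂ := ⟨_, rfl⟩
    have ht₁ : QuarticTwist.flip B p t = t + Pi.single p.2 e₁ := by rw [flip_eq_add_single, he₁]
    have ht₂ : QuarticTwist.flip B q t = t + Pi.single q.2 e₂ := by rw [flip_eq_add_single, he₂]
    have ht₁₂ : QuarticTwist.flip B q (QuarticTwist.flip B p t) = t + Pi.single p.2 e₁ + Pi.single q.2 e₂ := by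
      rw [flip_flip_of_ne B p q hpq t, he₁, he₂]
    have hadd := raffine_square B v' t hpq e₁ e₂
    rw [← ht₁₂, ← ht₁, ← ht₂] at hadd
    rw [cface₁_eq] at hf
    have key : Pi.single (s, t) 1 - tens B (raffine B u s) (raffine B v' t)
        = (Pi.single (s, t) 1 - Pi.single (s, QuarticTwist.flip B p t) 1 - Pi.single (s, QuarticTwist.flip B q t) 1
            + Pi.single (s, QuarticTwist.flip B q (QuarticTwist.flip B p t)) 1)
          + (Pi.single (s, QuarticTwist.flip B p t) 1 - tens B (raffine B u s) (raffine B v' (QuarticTwist.flip B p t)))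
          + (Pi.single (s, QuarticTwist.flip B q t) 1 - tens B (raffine B u s) (raffine B v' (QuarticTwist.flip B q t)))
          - (Pi.single (s, QuarticTwist.flip B q (QuarticTwist.flip B p t)) 1
              - tens B (raffine B u s) (raffine B v' (QuarticTwist.flip B q (QuarticTwist.flip B p t))))
          - tens B (raffine B u s) (raffine B v' t - raffine B v' (QuarticTwist.flip B p t) - raffine B v' (QuarticTwist.flip B q t)
              + raffine B v' (QuarticTwist.flip B q (QuarticTwist.flip B p t))) := by
      rw [tens_add_right, tens_sub_right, tens_sub_right]; abel
    rw [key, hadd, tens_zero_right, sub_zero]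
    exact Submodule.sub_mem _ (Submodule.add_mem _ (Submodule.add_mem _ hf i₁) i₂) i₁₂
  · -- (C0) the column relation at a 2-atom in coordinate 0
    simp only at hsb hrel
    subst hsb
    have hu' : u = u' := isUpper_unique B (isUpper_atom B h3 u' b 2) hu
    subst hu'
    have hlee : lee 2 = 2 ∧ lee 1 = 1 ∧ lee (-1) = 1 := ⟨rfl, rfl, rfl⟩
    have im := IH (atom B u b (-1)) t u v (by rw [pot_mk, pot_mk, Phi_atom B h3, Phi_atom B h3, hlee.1, hlee.2.2]; omega)
      (isUpper_atom B h3 u b (-1)) hv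
    have ip := IH (atom B u b 1) t u v (by rw [pot_mk, pot_mk, Phi_atom B h3, Phi_atom B h3, hlee.1, hlee.2.1]; omega)
      (isUpper_atom B h3 u b 1) hv
    have ic := IH (cst B u) t u v (by rw [pot_mk, pot_mk, Phi_atom B h3, Phi_cst B h3 u b, hlee.1]; omega)
      (atom_zero B u b ▸ isUpper_atom B h3 u b 0) hv
    rw [raffine_atom B u b (Or.inr (Or.inr rfl))] at im
    rw [raffine_atom B u b (Or.inr (Or.inl rfl))] at ip
    rw [raffine_cst B u b] at ic
    have key : Pi.single (atom B u b 2, t) 1 - tens B (raffine B u (atom B u b 2)) (raffine B v t)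
        = (Pi.single (atom B u b 2, t) 1 - Pi.single (atom B u b (-1), t) 1 - Pi.single (atom B u b 1, t) 1 + Pi.single (cst B u, t) 1)
          + (Pi.single (atom B u b (-1), t) 1 - tens B (Pi.single (atom B u b (-1)) 1) (raffine B v t))
          + (Pi.single (atom B u b 1, t) 1 - tens B (Pi.single (atom B u b 1) 1) (raffine B v t))
          - (Pi.single (cst B u, t) 1 - tens B (Pi.single (cst B u) 1) (raffine B v t)) := by
      rw [raffine_two_atom, tens_sub_left, tens_add_left]; abel
    rw [key]
    exact Submodule.sub_mem _ (Submodule.add_mem _ (Submodule.add_mem _ hrel im) ip) ic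
  · -- (C1) the column relation at a 2-atom in coordinate 1
    simp only at htb hrel
    subst htb
    have hv' : v = v' := isUpper_unique B (isUpper_atom B h3 v' b 2) hv
    subst hv'
    have hlee : lee 2 = 2 ∧ lee 1 = 1 ∧ lee (-1) = 1 := ⟨rfl, rfl, rfl⟩
    have im := IH s (atom B v b (-1)) u v (by rw [pot_mk, pot_mk, Phi_atom B h3, Phi_atom B h3, hlee.1, hlee.2.2]; omega)
      hu (isUpper_atom B h3 v b (-1))
    have ip := IH s (atom B v b 1) u v (by rw [pot_mk, pot_mk, Phi_atom B h3, Phi_atom B h3, hlee.1, hlee.2.1]; omega)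
      hu (isUpper_atom B h3 v b 1)
    have ic := IH s (cst B v) u v (by rw [pot_mk, pot_mk, Phi_atom B h3, Phi_cst B h3 v b, hlee.1]; omega)
      hu (atom_zero B v b ▸ isUpper_atom B h3 v b 0)
    rw [raffine_atom B v b (Or.inr (Or.inr rfl))] at im
    rw [raffine_atom B v b (Or.inr (Or.inl rfl))] at ip
    rw [raffine_cst B v b] at ic
    have key : Pi.single (s, atom B v b 2) 1 - tens B (raffine B u s) (raffine B v (atom B v b 2))
        = (Pi.single (s, atom B v b 2) 1 - Pi.single (s, atom B v b (-1)) 1 - Pi.single (s, atom B v b 1) 1 + Pi.single (s, cst B v) 1)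
          + (Pi.single (s, atom B v b (-1)) 1 - tens B (raffine B u s) (Pi.single (atom B v b (-1)) 1))
          + (Pi.single (s, atom B v b 1) 1 - tens B (raffine B u s) (Pi.single (atom B v b 1) 1))
          - (Pi.single (s, cst B v) 1 - tens B (raffine B u s) (Pi.single (cst B v) 1)) := by
      rw [raffine_two_atom, tens_sub_right, tens_add_right]; abel
    rw [key]
    exact Submodule.sub_mem _ (Submodule.add_mem _ (Submodule.add_mem _ hrel im) ip) ic

omit [AddGroup B] in
/-- **Reduction through a coordinate-`1` cross square** whose corners have upper end `v` (the passive `x` with upper end `u`; `t` itself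
arbitrary, balanced or not): `e_{(x,t)} − raffine u x ⊗ raffine v t ∈ N`. [folklore] -/
theorem biaffine_of_square₁ {N : Submodule ℤ (Ty₂ B → ℤ)}
    (hUU : ∀ (s t : Ty B) (u v : ZMod 4), IsUpper B u s → IsUpper B v t → Pi.single (s, t) 1 - tens B (raffine B u s) (raffine B v t) ∈ N)
    {x t : Ty B} {u v : ZMod 4} (hx : IsUpper B u x) {p q : ZMod 2 × B} (hpq : p.2 ≠ q.2)
    (hf : tens B (Pi.single x 1) (faceVec B t p q) ∈ N) (r1 : IsUpper B v (QuarticTwist.flip B p t))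
    (r2 : IsUpper B v (QuarticTwist.flip B q t)) (r12 : IsUpper B v (QuarticTwist.flip B q (QuarticTwist.flip B p t))) :
    Pi.single (x, t) 1 - tens B (raffine B u x) (raffine B v t) ∈ N := by
  have i₁ := hUU x _ u v hx r1
  have i₂ := hUU x _ u v hx r2
  have i₁₂ := hUU x _ u v hx r12
  obtain ⟨e₁, he₁⟩ : ∃ e₁, step p.1 (t p.2) = e₁ := ⟨_, rfl⟩
  obtain ⟨e₂, he₂⟩ : ∃ e₂, step q.1 (t q.2) = e₂ := ⟨_, rfl⟩
  have ht₁ : QuarticTwist.flip B p t = t + Pi.single p.2 e₁ := by rw [flip_eq_add_single, he₁]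
  have ht₂ : QuarticTwist.flip B q t = t + Pi.single q.2 e₂ := by rw [flip_eq_add_single, he₂]
  have ht₁₂ : QuarticTwist.flip B q (QuarticTwist.flip B p t) = t + Pi.single p.2 e₁ + Pi.single q.2 e₂ := by
    rw [flip_flip_of_ne B p q hpq t, he₁, he₂]
  have hadd := raffine_square B v t hpq e₁ e₂
  rw [← ht₁₂, ← ht₁, ← ht₂] at hadd
  rw [cface₁_eq] at hf
  have key : Pi.single (x, t) 1 - tens B (raffine B u x) (raffine B v t)
      = (Pi.single (x, t) 1 - Pi.single (x, QuarticTwist.flip B p t) 1 - Pi.single (x, QuarticTwist.flip B q t) 1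
          + Pi.single (x, QuarticTwist.flip B q (QuarticTwist.flip B p t)) 1)
        + (Pi.single (x, QuarticTwist.flip B p t) 1 - tens B (raffine B u x) (raffine B v (QuarticTwist.flip B p t)))
        + (Pi.single (x, QuarticTwist.flip B q t) 1 - tens B (raffine B u x) (raffine B v (QuarticTwist.flip B q t)))
        - (Pi.single (x, QuarticTwist.flip B q (QuarticTwist.flip B p t)) 1
            - tens B (raffine B u x) (raffine B v (QuarticTwist.flip B q (QuarticTwist.flip B p t))))
        - tens B (raffine B u x) (raffine B v t - raffine B v (QuarticTwist.flip B p t) - raffine B v (QuarticTwist.flip B q t)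
            + raffine B v (QuarticTwist.flip B q (QuarticTwist.flip B p t))) := by
    rw [tens_add_right, tens_sub_right, tens_sub_right]; abel
  rw [key, hadd, tens_zero_right, sub_zero]
  exact Submodule.sub_mem _ (Submodule.add_mem _ (Submodule.add_mem _ hf i₁) i₂) i₁₂

omit [AddGroup B] in
/-- **Reduction through a coordinate-`0` cross square** whose corners have upper end `u` (the passive `y` with upper end `v`; `s` itself
arbitrary): `e_{(s,y)} − raffine u s ⊗ raffine v y ∈ N`. [folklore] -/
theorem biaffine_of_square₀ {N : Submodule ℤ (Ty₂ B → ℤ)}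
    (hUU : ∀ (s t : Ty B) (u v : ZMod 4), IsUpper B u s → IsUpper B v t → Pi.single (s, t) 1 - tens B (raffine B u s) (raffine B v t) ∈ N)
    {s y : Ty B} {u v : ZMod 4} (hy : IsUpper B v y) {p q : ZMod 2 × B} (hpq : p.2 ≠ q.2)
    (hf : tens B (faceVec B s p q) (Pi.single y 1) ∈ N) (r1 : IsUpper B u (QuarticTwist.flip B p s))
    (r2 : IsUpper B u (QuarticTwist.flip B q s)) (r12 : IsUpper B u (QuarticTwist.flip B q (QuarticTwist.flip B p s))) :
    Pi.single (s, y) 1 - tens B (raffine B u s) (raffine B v y) ∈ N := by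
  have i₁ := hUU _ y u v r1 hy
  have i₂ := hUU _ y u v r2 hy
  have i₁₂ := hUU _ y u v r12 hy
  obtain ⟨e₁, he₁⟩ : ∃ e₁, step p.1 (s p.2) = e₁ := ⟨_, rfl⟩
  obtain ⟨e₂, he₂⟩ : ∃ e₂, step q.1 (s q.2) = e₂ := ⟨_, rfl⟩
  have hs₁ : QuarticTwist.flip B p s = s + Pi.single p.2 e₁ := by rw [flip_eq_add_single, he₁]
  have hs₂ : QuarticTwist.flip B q s = s + Pi.single q.2 e₂ := by rw [flip_eq_add_single, he₂]
  have hs₁₂ : QuarticTwist.flip B q (QuarticTwist.flip B p s) = s + Pi.single p.2 e₁ + Pi.single q.2 e₂ := by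
    rw [flip_flip_of_ne B p q hpq s, he₁, he₂]
  have hadd := raffine_square B u s hpq e₁ e₂
  rw [← hs₁₂, ← hs₁, ← hs₂] at hadd
  rw [cface₀_eq] at hf
  have key : Pi.single (s, y) 1 - tens B (raffine B u s) (raffine B v y)
      = (Pi.single (s, y) 1 - Pi.single (QuarticTwist.flip B p s, y) 1 - Pi.single (QuarticTwist.flip B q s, y) 1
          + Pi.single (QuarticTwist.flip B q (QuarticTwist.flip B p s), y) 1)
        + (Pi.single (QuarticTwist.flip B p s, y) 1 - tens B (raffine B u (QuarticTwist.flip B p s)) (raffine B v y))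
        + (Pi.single (QuarticTwist.flip B q s, y) 1 - tens B (raffine B u (QuarticTwist.flip B q s)) (raffine B v y))
        - (Pi.single (QuarticTwist.flip B q (QuarticTwist.flip B p s), y) 1
            - tens B (raffine B u (QuarticTwist.flip B q (QuarticTwist.flip B p s))) (raffine B v y))
        - tens B (raffine B u s - raffine B u (QuarticTwist.flip B p s) - raffine B u (QuarticTwist.flip B q s)
            + raffine B u (QuarticTwist.flip B q (QuarticTwist.flip B p s))) (raffine B v y) := by
    rw [tens_add_left, tens_sub_left, tens_sub_left]; abel
  rw [key, hadd, tens_zero_left, sub_zero]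
  exact Submodule.sub_mem _ (Submodule.add_mem _ (Submodule.add_mem _ hf i₁) i₂) i₁₂

/-! ## §2 The screw hands over a Weil lift -/

/-- **THE WEIL LIFT FROM A SCREW PAIR TYPE.**  See the module docstring: from the mixed face at the screw pair type `(ψ, ψ′)` and a
coordinate-`1` square at `(ψ⁻, ψ′)` offering the upper end `v` of `ψ⁻`, a motion-stable `N` with the octic pairs, the mixed squares, the
D-moves, the coordinate-`1` X-lifts and shaped reducing faces contains `e_{cst (v+1)} ⊗ w_{v+1}`. [folklore] -/
theorem cst_tens_Wvec_mem_of_screw (h3 : 3 ≤ Fintype.card B) {N : Submodule ℤ (Ty₂ B → ℤ)}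
    (hmot : ∀ x ∈ N, ∀ (e : Bool) (h : ZMod 4 × B), transl₂ B e h x ∈ N) (hP : pairs₂ B ≤ N)
    (hsq : ∀ (u : ZMod 4) (b : B) (k : ZMod 4) (u' : ZMod 4) (b' : B) (k' : ZMod 4), (k = 1 ∨ k = -1) → (k' = 1 ∨ k' = -1) →
      tens B (Pi.single (atom B u b k) 1 - Pi.single (cst B u) 1) (Pi.single (atom B u' b' k') 1 - Pi.single (cst B u') 1) ∈ N)
    (hD0 : ∀ (u : ZMod 4) (b : B) (k : ZMod 4) (u' u'' : ZMod 4), (k = 1 ∨ k = -1) →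
      tens B (Pi.single (atom B u b k) 1 - Pi.single (cst B u) 1) (Pi.single (cst B u') 1 - Pi.single (cst B u'') 1) ∈ N)
    (hD1 : ∀ (u : ZMod 4) (b : B) (k : ZMod 4) (u' u'' : ZMod 4), (k = 1 ∨ k = -1) →
      tens B (Pi.single (cst B u') 1 - Pi.single (cst B u'') 1) (Pi.single (atom B u b k) 1 - Pi.single (cst B u) 1) ∈ N)
    (hX1 : ∀ (u : ZMod 4) (b : B) (u' : ZMod 4), tens B (Pi.single (cst B u') 1) (Xvec B u b) ∈ N)
    (hShape : ∀ T : Ty₂ B, 2 ≤ pot B T → (¬ ∀ w, IsMin B w T.1) → (¬ ∀ w, IsMin B w T.2) → Shaped B N T)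
    {τ : B} {ψ ψ' ψm ψ'm : Ty B} (hE1 : tw B (1, τ) ψ' = ψ) (hE2 : tw B (0, τ) ψ = ψ') (hE3 : tw B (0, τ) ψm = ψ'm)
    {v : ZMod 4} (hum : IsUpper B v ψm) {p' q' : ZMod 2 × B} (hpq : p'.2 ≠ q'.2)
    (r1 : IsUpper B v (QuarticTwist.flip B p' ψ')) (r2 : IsUpper B v (QuarticTwist.flip B q' ψ'))
    (r12 : IsUpper B v (QuarticTwist.flip B q' (QuarticTwist.flip B p' ψ')))
    (hF₀ : tens B (Pi.single ψ 1 - Pi.single ψm 1) (Pi.single ψ' 1 - Pi.single ψ'm 1) ∈ N)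
    (hF₁ : tens B (Pi.single ψm 1) (faceVec B ψ' p' q') ∈ N) :
    tens B (Pi.single (cst B (v + 1)) 1) (Wvec B (v + 1)) ∈ N := by
  have hUU : ∀ (s t : Ty B) (u v : ZMod 4), IsUpper B u s → IsUpper B v t →
      Pi.single (s, t) 1 - tens B (raffine B u s) (raffine B v t) ∈ N := fun s t u v hu hv => biaffine_mem B h3 hShape s t hu hv
  have hg : ((0 : ZMod 4), τ) + (1, 0) = (1, τ) := Prod.ext (zero_add 1) (add_zero τ)
  -- upper ends of the transported neighbours
  have hum' : IsUpper B v ψ'm := by rw [← hE3, isUpper_tw_iff, sub_zero]; exact hum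
  have humm : IsUpper B (v + 1) (tw B (1, τ) ψ'm) := by rw [isUpper_tw_iff, add_sub_cancel_right]; exact hum'
  -- the transported coordinate-0 square at `(ψ, ψ'm)`
  have hF₁' : tens B (faceVec B ψ (plc B (1, τ) p') (plc B (1, τ) q')) (Pi.single ψ'm 1) ∈ N := by
    have h := hmot _ hF₁ true (0, τ)
    rw [transl₂_true_tens, hg, transl_faceVec, transl_single, hE1, hE3] at h
    exact h
  have r1' : IsUpper B (v + 1) (QuarticTwist.flip B (plc B (1, τ) p') ψ) := by
    rw [← hE1, ← tw_flip', isUpper_tw_iff, add_sub_cancel_right]; exact r1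
  have r2' : IsUpper B (v + 1) (QuarticTwist.flip B (plc B (1, τ) q') ψ) := by
    rw [← hE1, ← tw_flip', isUpper_tw_iff, add_sub_cancel_right]; exact r2
  have r12' : IsUpper B (v + 1) (QuarticTwist.flip B (plc B (1, τ) q') (QuarticTwist.flip B (plc B (1, τ) p') ψ)) := by
    rw [← hE1, ← tw_flip', ← tw_flip', isUpper_tw_iff, add_sub_cancel_right]; exact r12
  -- the three corner reductions and the reduction of `e_{T₀}`
  have R1 := biaffine_of_square₁ B hUU hum hpq hF₁ r1 r2 r12
  have R2 := biaffine_of_square₀ B hUU hum' (plc_snd_ne B hpq) hF₁' r1' r2' r12'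
  have R3 := hUU ψm ψ'm v v hum hum'
  have hD : Pi.single (ψ, ψ') 1 - (tens B (raffine B v ψm) (raffine B v ψ') + tens B (raffine B (v + 1) ψ) (raffine B v ψ'm)
      - tens B (raffine B v ψm) (raffine B v ψ'm)) ∈ N := by
    have e : Pi.single (ψ, ψ') 1 - (tens B (raffine B v ψm) (raffine B v ψ') + tens B (raffine B (v + 1) ψ) (raffine B v ψ'm)
        - tens B (raffine B v ψm) (raffine B v ψ'm))
        = tens B (Pi.single ψ 1 - Pi.single ψm 1) (Pi.single ψ' 1 - Pi.single ψ'm 1)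
          + (Pi.single (ψm, ψ') 1 - tens B (raffine B v ψm) (raffine B v ψ'))
          + (Pi.single (ψ, ψ'm) 1 - tens B (raffine B (v + 1) ψ) (raffine B v ψ'm))
          - (Pi.single (ψm, ψ'm) 1 - tens B (raffine B v ψm) (raffine B v ψ'm)) := by
      rw [tens_sub_sub, ← single_eq_tens, ← single_eq_tens, ← single_eq_tens, ← single_eq_tens]; abel
    rw [e]
    exact Submodule.sub_mem _ (Submodule.add_mem _ (Submodule.add_mem _ hF₀ R1) R2) R3
  -- transport by the odd motion fixing `T₀`
  have hD' := hmot _ hD true (0, τ)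
  have hfix : act B true (0, τ) (ψ, ψ') = (ψ, ψ') := by
    rw [act_true]; show (tw B (0, τ) (tw B (1, 0) ψ'), tw B (0, τ) ψ) = _; rw [tw_tw, hg, hE1, hE2]
  rw [transl₂_sub, transl₂_single, transl₂_sub, transl₂_add, transl₂_true_tens, transl₂_true_tens, transl₂_true_tens, hg, hfix] at hD'
  simp only [transl_raffine, hE1, hE2, hE3, add_zero] at hD'
  -- the difference of the two reductions
  have hdiff : tens B (raffine B (v + 1) (tw B (1, τ) ψ'm)) (raffine B (v + 1) ψ' - raffine B v ψ'm)
      - tens B (raffine B v ψm) (raffine B v ψ' - raffine B v ψ'm) ∈ N := by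
    have e : tens B (raffine B (v + 1) (tw B (1, τ) ψ'm)) (raffine B (v + 1) ψ' - raffine B v ψ'm)
        - tens B (raffine B v ψm) (raffine B v ψ' - raffine B v ψ'm)
        = (Pi.single (ψ, ψ') 1 - (tens B (raffine B v ψm) (raffine B v ψ') + tens B (raffine B (v + 1) ψ) (raffine B v ψ'm)
            - tens B (raffine B v ψm) (raffine B v ψ'm)))
          - (Pi.single (ψ, ψ') 1 - (tens B (raffine B (v + 1) ψ) (raffine B v ψ'm)
            + tens B (raffine B (v + 1) (tw B (1, τ) ψ'm)) (raffine B (v + 1) ψ')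
            - tens B (raffine B (v + 1) (tw B (1, τ) ψ'm)) (raffine B v ψ'm))) := by
      rw [tens_sub_right, tens_sub_right]; abel
    rw [e]
    exact Submodule.sub_mem _ hD hD'
  -- strip the junk
  have hA : tens B (raffine B (v + 1) (tw B (1, τ) ψ'm) - raffine B v ψm) (raffine B v ψ' - raffine B v ψ'm) ∈ N := by
    refine tens_mem_of_mem_spanL_spanA B hsq hD1 (raffine_sub_raffine_mem B _ _ _ _) ?_
    have e : raffine B v ψ' - raffine B v ψ'm = (raffine B v ψ' - Pi.single (cst B v) 1) - (raffine B v ψ'm - Pi.single (cst B v) 1) := by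
      abel
    rw [e]
    exact Submodule.sub_mem _ (raffine_sub_cst_mem B v ψ') (raffine_sub_cst_mem B v ψ'm)
  have hB : tens B (raffine B (v + 1) (tw B (1, τ) ψ'm) - Pi.single (cst B (v + 1)) 1) (raffine B (v + 1) ψ' - raffine B v ψ') ∈ N :=
    tens_mem_of_mem_spanA_spanL B hsq hD0 (raffine_sub_cst_mem B _ _) (raffine_sub_raffine_mem B _ _ _ _)
  have hC : tens B (Pi.single (cst B (v + 1)) 1) (raffine B (v + 1) ψ' - raffine B v ψ') ∈ N := by
    have e : tens B (Pi.single (cst B (v + 1)) 1) (raffine B (v + 1) ψ' - raffine B v ψ')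
        = (tens B (raffine B (v + 1) (tw B (1, τ) ψ'm)) (raffine B (v + 1) ψ' - raffine B v ψ'm)
            - tens B (raffine B v ψm) (raffine B v ψ' - raffine B v ψ'm))
          - tens B (raffine B (v + 1) (tw B (1, τ) ψ'm) - raffine B v ψm) (raffine B v ψ' - raffine B v ψ'm)
          - tens B (raffine B (v + 1) (tw B (1, τ) ψ'm) - Pi.single (cst B (v + 1)) 1) (raffine B (v + 1) ψ' - raffine B v ψ') := by
      rw [tens_sub_left, tens_sub_left, tens_sub_right, tens_sub_right, tens_sub_right, tens_sub_right, tens_sub_right]; abel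
    rw [e]
    exact Submodule.sub_mem _ (Submodule.sub_mem _ hdiff hA) hB
  -- the shift identity
  have hshift := cst_tens_shift_mem B hP hX1 hD1 (v + 1) v ψ'
  have e : tens B (Pi.single (cst B (v + 1)) 1) (Wvec B (v + 1))
      = tens B (Pi.single (cst B (v + 1)) 1) (raffine B (v + 1) ψ' - raffine B v ψ')
        - (tens B (Pi.single (cst B (v + 1)) 1) (raffine B (v + 1) ψ' - raffine B v ψ') - tens B (Pi.single (cst B (v + 1)) 1) (Wvec B (v + 1))) := by
    abel
  rw [e]
  exact Submodule.sub_mem _ hC hshift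

end Summit.HodgeConjecture.CorCM.Census.OcticTwist
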